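import Literature.Geometry.Lorentzian.Stationary
import Literature.Geometry.Lorentzian.KillingFieldCurvatureIdentities
import Literature.Geometry.Lorentzian.NullScreenAlgebra

/-!
# `ErgoregionBombModT` — `0 ≤ □ g(T,T)` at every hovering Killing light point of a vacuum hole
# (crux stmt-FinalStateConjecture-17838, line `killing-light-points`, lead c4)

Route `ZeroEnergyKerrOrBomb` of the Final State Conjecture, crux
`Summit.FinalStateConjecture.FinalStateConjecture.Theses.ZeroEnergyKerrOrBomb.ErgoregionBombModT`,
line `killing-light-points` (skeleton v4: the crux is, losslessly, `OffWallBomb ∧ LightPointBomb`).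
`LightPointBomb` concerns the *Killing light points* `p` of the domain of outer communications:
`g(T,T)(p) = 0` with `∇_T T = κ T` for the stationary Killing field `T`; `κ = 0` is the HOVERING
case.  This file certifies c1's W2 remark "`□λ = 2 F·F ≥ 0` at hovering light points" as the
registered certificate `dalembertian_val_killing_nonneg_of_hoveringLightPoint` of the crux item
(a certificate, not an obligation of the skeleton):

**Theorem.**  In a Ricci-flat `StationaryAFBlackHole` presentation, at every point `p` with
`g(T,T)(p) = 0`, `T(p) ≠ 0` and `∇_T T (p) = 0` one has `0 ≤ □ g(T,T) (p)`.

Proof (pointwise linear algebra; O'Neill 1983, Ch. 9, Ex. 9 (c)).  With `λ = g(T,T)`,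
`A = ∇T(p)` and `ℓ = T(p)`: `□λ = -2 tr(A ∘ A) - 2 Ric(T,T)`
(`IsKillingField.dalembertian_val_self`) and `Ric = 0`.  The Killing equation makes `A` `g`-skew,
and `A ℓ = 0`, so `g(A v, ℓ) = -g(v, A ℓ) = 0` for all `v`: the range of `A` is in `ℓ^⊥`, where
`g` is positive semidefinite (`nonneg_of_orthogonal_null`).  Over an orthonormal screen frame `e`
of `ℓ` (`exists_orthonormal_screen`) the trace of `R = A ∘ A` (`R ℓ = 0`, `R u ⊥ ℓ`) is
`∑ᵢ g(A (A eᵢ), eᵢ) = -∑ᵢ g(A eᵢ, A eᵢ) ≤ 0` (`trace_eq_sum_screen_of_null`, skewness), hence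
`□λ(p) = -2 tr(A ∘ A) ≥ 0`.  The EVANESCENT species (local maxima of `λ`, lead c4's
`Theorems/ZeroEnergyKerrOrBombErgoregionBombModTEvanescentSpecial.lean`) is the extremal case
`□λ = 0` of this inequality.

Contents: `trace_comp_self_nonpos_of_skew_of_apply_null` (linear algebra at a null vector),
`dalembertian_val_killing_nonneg_of_leviCivita_self_eq_zero` (pointwise, named hypotheses) and the
closed-form certificate `dalembertian_val_killing_nonneg_of_hoveringLightPoint`.

References: B. O'Neill, *Semi-Riemannian geometry* (1983), Ch. 5, Lemma 5.26; Ch. 9, Ex. 9 (c);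
S. W. Hawking, G. F. R. Ellis (1973), §4.2 (pseudo-orthonormal frames); crux workfiles
`Cruxes/ErgoregionBombModT/Lines/killing_light_points.lean` (skeleton v4).
-/

noncomputable section

open Bundle Set Filter Function Module
open scoped Manifold Topology

-- summit = problem name (D-0017)
set_option linter.dupNamespace false

namespace Summit.FinalStateConjecture.FinalStateConjecture.Theorems.ErgoregionBombModT

open Literature.Geometry.Lorentzian

/-! ### Linear algebra at a null vector of a Lorentzian scalar product -/

section Algebra

variable {V : Type*} [NormedAddCommGroup V] [NormedSpace ℝ V] [FiniteDimensional ℝ V]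
  (B : V →L[ℝ] V →L[ℝ] ℝ)

/-- **The square of a skew map killing a null vector has nonpositive trace.**  Let `B` be a
Lorentzian scalar product on `V` (a timelike `T`, `B` positive definite on timelike
orthocomplements), `ℓ ≠ 0` a null vector with an orthonormal screen frame `e` (`#ι + 2 = dim V`),
and `A` a `B`-skew endomorphism with `A ℓ = 0`.  Then `tr (A ∘ A) = -∑ᵢ B(A eᵢ, A eᵢ) ≤ 0`:
skewness gives `B(A v, ℓ) = -B(v, A ℓ) = 0`, so `A ∘ A` kills `ℓ` and maps into `ℓ^⊥`, its trace
is the screen sum `∑ᵢ B(A (A eᵢ), eᵢ) = -∑ᵢ B(A eᵢ, A eᵢ)` (`trace_eq_sum_screen_of_null`), and each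
`A eᵢ ⊥ ℓ` has `B(A eᵢ, A eᵢ) ≥ 0` (`nonneg_of_orthogonal_null`; O'Neill 1983, Ch. 5, Lemma 5.26).
[folklore] -/
theorem trace_comp_self_nonpos_of_skew_of_apply_null (hB : ∀ v w : V, B v w = B w v)
    (hpos : ∀ t w : V, B t t < 0 → B t w = 0 → w ≠ 0 → 0 < B w w) {T : V} (hT : B T T < 0)
    {ι : Type*} [Fintype ι] [DecidableEq ι] {e : ι → V}
    (hon : ∀ i j, B (e i) (e j) = if i = j then 1 else 0) {ℓ : V} (hℓ0 : B ℓ ℓ = 0) (hℓ : ℓ ≠ 0)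
    (hℓe : ∀ i, B (e i) ℓ = 0) (hcard : Fintype.card ι + 2 = finrank ℝ V)
    (A : V →ₗ[ℝ] V) (hA : ∀ v w, B (A v) w + B v (A w) = 0) (hAℓ : A ℓ = 0) :
    LinearMap.trace ℝ V (A ∘ₗ A) = -∑ i, B (A (e i)) (A (e i)) ∧
      LinearMap.trace ℝ V (A ∘ₗ A) ≤ 0 := by
  -- `A v ⊥ ℓ`
  have hAskewℓ : ∀ v, B (A v) ℓ = 0 := fun v ↦ by
    have := hA v ℓ
    rw [hAℓ, map_zero] at this
    linarith
  have hAAℓ : (A ∘ₗ A) ℓ = 0 := by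
    rw [LinearMap.comp_apply, hAℓ, map_zero]
  have htr := trace_eq_sum_screen_of_null B hB hpos hT hon hℓ0 hℓ hℓe hcard (A ∘ₗ A) hAAℓ
    (fun u ↦ hAskewℓ (A u))
  have hsum : ∑ i, B ((A ∘ₗ A) (e i)) (e i) = -∑ i, B (A (e i)) (A (e i)) := by
    rw [← Finset.sum_neg_distrib]
    refine Finset.sum_congr rfl fun i _ ↦ ?_
    rw [LinearMap.comp_apply]
    have := hA (A (e i)) (e i)
    linarith
  have htr' : LinearMap.trace ℝ V (A ∘ₗ A) = -∑ i, B (A (e i)) (A (e i)) := htr.trans hsum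
  refine ⟨htr', ?_⟩
  rw [htr', neg_nonpos]
  exact Finset.sum_nonneg fun i _ ↦ nonneg_of_orthogonal_null B hpos hℓ0 hℓ (hAskewℓ (e i))

end Algebra

/-! ### Hovering light points of a stationary vacuum space-time -/

section Manifold

variable {𝓑 : StationaryAFBlackHole.{0}} [𝓑.metric.HasLeviCivita]

/-- **`0 ≤ □ g(T,T)` at a hovering light point.**  Let `T` be the stationary Killing field of `𝓑`
and `p` a point with `Ric(T,T)(p) = 0`, `g(T,T)(p) = 0`, `T(p) ≠ 0` and `∇_T T (p) = 0`.  Then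
`0 ≤ □ g(T,T) (p)`: by O'Neill 1983, Ch. 9, Ex. 9 (c), `□ g(T,T) = -2 tr(∇T ∘ ∇T) - 2 Ric(T,T)`
(`IsKillingField.dalembertian_val_self`), and `tr(∇T ∘ ∇T)(p) ≤ 0` because the skew map `∇T(p)`
kills the null vector `T(p)` (`trace_comp_self_nonpos_of_skew_of_apply_null` over an orthonormal
screen frame of `T(p)`, `exists_orthonormal_screen`). [cite: ONeill1983, Ch. 9, Ex. 9 (c)] -/
theorem dalembertian_val_killing_nonneg_of_leviCivita_self_eq_zero {p : 𝓑.carrier}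
    (hRic : 𝓑.metric.ricci p (𝓑.killing p) (𝓑.killing p) = 0)
    (hnull : 𝓑.metric.val p (𝓑.killing p) (𝓑.killing p) = 0) (hT0 : 𝓑.killing p ≠ 0)
    (hacc : 𝓑.metric.leviCivita 𝓑.killing p (𝓑.killing p) = 0) :
    0 ≤ 𝓑.metric.dalembertian (fun y ↦ 𝓑.metric.val y (𝓑.killing y) (𝓑.killing y)) p := by
  set g := 𝓑.metric.toPseudoRiemannianMetric with hg
  have hK : g.IsKillingField 𝓑.killing := 𝓑.isStationaryKilling.isKillingField
  -- the skew endomorphism `A = ∇T(p)` kills `T(p)`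
  have hA : ∀ v w,
      g.val p ((g.leviCivita 𝓑.killing p : TangentSpace (𝓡 4) p →ₗ[ℝ] TangentSpace (𝓡 4) p) v) w +
        g.val p v ((g.leviCivita 𝓑.killing p : TangentSpace (𝓡 4) p →ₗ[ℝ] TangentSpace (𝓡 4) p) w)
          = 0 :=
    fun v w ↦ hK.2 p v w
  have hAℓ : (g.leviCivita 𝓑.killing p : TangentSpace (𝓡 4) p →ₗ[ℝ] TangentSpace (𝓡 4) p)
      (𝓑.killing p) = 0 := hacc
  -- an orthonormal screen frame of the null vector `T(p)`
  obtain ⟨Tm, hTm⟩ := 𝓑.metric.exists_timelike p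
  obtain ⟨e, hon, heℓ, -⟩ := exists_orthonormal_screen (V := E4) (g.val p)
    (fun v w ↦ g.symm p v w) (fun t w ↦ 𝓑.metric.pos_of_orthogonal p t w) hTm hnull hT0
  have h4 : finrank ℝ E4 = 4 := finrank_euclideanSpace_fin
  have hcard : Fintype.card (Fin (finrank ℝ E4 - 2)) + 2 = finrank ℝ E4 := by
    rw [Fintype.card_fin, h4]
  have htr := (trace_comp_self_nonpos_of_skew_of_apply_null (V := E4) (g.val p)
    (fun v w ↦ g.symm p v w) (fun t w ↦ 𝓑.metric.pos_of_orthogonal p t w) hTm hon hnull hT0 heℓ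
    hcard (g.leviCivita 𝓑.killing p : TangentSpace (𝓡 4) p →ₗ[ℝ] TangentSpace (𝓡 4) p)
    hA hAℓ).2
  have htr' : LinearMap.trace ℝ (TangentSpace (𝓡 4) p)
      ((g.leviCivita 𝓑.killing p : TangentSpace (𝓡 4) p →ₗ[ℝ] TangentSpace (𝓡 4) p) ∘ₗ
        (g.leviCivita 𝓑.killing p : TangentSpace (𝓡 4) p →ₗ[ℝ] TangentSpace (𝓡 4) p)) ≤ 0 :=
    htr
  have hRic' : g.ricci p (𝓑.killing p) (𝓑.killing p) = 0 := hRic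
  have h := hK.dalembertian_val_self ENat.LEInfty.out p
  rw [hRic', mul_zero, sub_zero] at h
  have h2 : (0 : ℝ) ≤ -2 * LinearMap.trace ℝ (TangentSpace (𝓡 4) p)
      ((g.leviCivita 𝓑.killing p : TangentSpace (𝓡 4) p →ₗ[ℝ] TangentSpace (𝓡 4) p) ∘ₗ
        (g.leviCivita 𝓑.killing p : TangentSpace (𝓡 4) p →ₗ[ℝ] TangentSpace (𝓡 4) p)) := by
    linarith
  exact h2.trans_eq h.symm

end Manifold

/-! ### Closed form (registered certificate of crux stmt-FinalStateConjecture-17838) -/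

/-- **`0 ≤ □ g(T,T)` at every hovering Killing light point of a vacuum hole** (registered
certificate `dalembertian_val_killing_nonneg_of_hoveringLightPoint` of crux
stmt-FinalStateConjecture-17838 — a certificate, not an obligation of the skeleton).  For a
Ricci-flat `StationaryAFBlackHole` presentation with stationary Killing field `T`, at every point
`p` where `T` is null, non-zero and geodesic (`∇_T T = 0`, surface gravity `κ = 0`: a HOVERING light
point) the d'Alembertian of `λ = g(T,T)` is nonnegative: `□λ(p) = -2 tr(∇T ∘ ∇T) ≥ 0`
(O'Neill 1983, Ch. 9, Ex. 9 (c), with `Ric = 0` and `tr(∇T ∘ ∇T) ≤ 0` for the skew map `∇T(p)`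
killing the null vector `T(p)`).  The evanescent species (local maxima of `λ`) is the extremal case
`□λ = 0`. [cite: ONeill1983, Ch. 9, Ex. 9 (c)] -/
theorem dalembertian_val_killing_nonneg_of_hoveringLightPoint : ∀ (𝓑 : Literature.Geometry.Lorentzian.StationaryAFBlackHole.{0}) [𝓑.metric.HasLeviCivita], 𝓑.metric.toPseudoRiemannianMetric.IsRicciFlat → ∀ p : 𝓑.carrier, 𝓑.metric.val p (𝓑.killing p) (𝓑.killing p) = 0 → 𝓑.killing p ≠ 0 → 𝓑.metric.leviCivita 𝓑.killing p (𝓑.killing p) = 0 → 0 ≤ 𝓑.metric.dalembertian (fun y ↦ 𝓑.metric.val y (𝓑.killing y) (𝓑.killing y)) p := by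
  intro 𝓑 _ hRic p hnull hT0 hacc
  have hR : 𝓑.metric.ricci p (𝓑.killing p) (𝓑.killing p) = 0 := by
    rw [show 𝓑.metric.ricci p = 0 from hRic p]; rfl
  exact dalembertian_val_killing_nonneg_of_leviCivita_self_eq_zero hR hnull hT0 hacc

end Summit.FinalStateConjecture.FinalStateConjecture.Theorems.ErgoregionBombModT

end
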